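import Summits.Parity.GeneralizedHardyLittlewood.Theorems.LiouvilleMADFanDecorrelationStubFanOfHeightLaws
import Summits.Parity.GeneralizedHardyLittlewood.Theorems.LiouvilleMADFanDecorrelationStubPointwiseOfBinaryForms

/-!
# `FanDecorrelation` from binary-forms Chowla and the wide height law (line `SketchIdeator5`)

Stub `stub_fanOfBinaryFormsWide` of the crux `FanDecorrelation`
(`Summit.Parity.GeneralizedHardyLittlewood.Theses.LiouvilleMAD`, stmt-Parity-13318), line
`SketchIdeator5` — the line's NORMAL FORM after the reshape of the continuation lead c3, as ONE
importable theorem: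

`BinaryFormsChowla ∧ WideHeightLaw ⟹ FanDecorrelation` (body verbatim).

Here *binary-forms Chowla* (stub 3a of the skeleton `Cruxes/FanDecorrelation/Lines/SketchIdeator5.lean`)
is power-saving Chowla for two non-proportional linear forms `u ↦ un₁+a₁, un₂+a₂` (dilations `≤ 2X`,
dyadic-scale shifts `|aᵢ| ≤ 2nᵢX`, sub-intervals of `(X,2X]`), the common parent of the route's rank-4
crux `DilatedChowla` (`stub_dilatedChowlaOfBinaryForms`) and of the line's pointwise law
(`stub_pointwiseOfBinaryForms`, p116133); the *wide height law* (`stub_wideLaw`) is square-root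
cancellation across `≥ M^δ` smoothly weighted lag correlations — the genuinely second-order half.
Both hypotheses are conjecture-grade; this file only composes the landed pieces:
`stub_fanOfHeightLaws (stub_pointwiseOfBinaryForms h₁) h₂` (p111343 ∘ p116133).
-/

namespace Summit.Parity.GeneralizedHardyLittlewood.Theorems.FanDecorrelation.FanOfBinaryFormsWide

/-- Stub `stub_fanOfBinaryFormsWide` of crux `FanDecorrelation` (line `SketchIdeator5`, stub 9):
**binary-forms Chowla ∧ wide height law ⟹ the body of `FanDecorrelation`**.
Hypothesis 1: binary-forms Chowla (stub 3a verbatim) — `∃ κ > 0, C` with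
`|Σ_{u∈(X,X+L]} λ(un₁+a₁)λ(un₂+a₂)| ≤ C·X^{1−κ}` for `L ≤ X`, `1 ≤ nᵢ ≤ 2X`, `|aᵢ| ≤ 2nᵢX`,
`nᵢX + aᵢ > 0`, `n₁a₂ ≠ n₂a₁`.  Hypothesis 2: the wide height law (`stub_wideLaw` verbatim) — for
every smooth `φ` supported in `[−2,2]`, `c ≠ 0`, `δ > 0` there are `ϑ < 1/4`, `C` with
`|Σ_j φ((j−P)/D)·D(kj)| ≤ C·M^{3/4+ϑ}` for `M^δ ≤ D ≤ Q/8`, `Q ≤ P ≤ 2Q`, `k ≠ 0`, `1 ≤ n ≠ n' ≤ 2M`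
(`Q = ⌊√M⌋+1`, `D(h) = Σ_{m−m'=h} λ(mn+c)λ(m'n'+c)`).  Conclusion: for every `c ≠ 0` there are
`ϑ < 1/4`, `C` with `|Σ_{j∈[Q,2Q)} D(kj)| ≤ C·M^{3/4+ϑ}` for all `M`, `1 ≤ n ≠ n' ≤ 2M`, `k ≠ 0`.
Proof: `stub_fanOfHeightLaws ∘ stub_pointwiseOfBinaryForms`. [folklore] -/
theorem stub_fanOfBinaryFormsWide :
    (∃ κ : ℝ, 0 < κ ∧ ∃ C : ℝ, ∀ X L n₁ n₂ : ℕ, ∀ a₁ a₂ : ℤ,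
      L ≤ X → 1 ≤ n₁ → 1 ≤ n₂ → n₁ ≤ 2 * X → n₂ ≤ 2 * X →
        0 < (n₁ : ℤ) * X + a₁ → 0 < (n₂ : ℤ) * X + a₂ →
          |a₁| ≤ 2 * (n₁ : ℤ) * X → |a₂| ≤ 2 * (n₂ : ℤ) * X →
            (n₁ : ℤ) * a₂ ≠ (n₂ : ℤ) * a₁ →
              |∑ u ∈ Finset.Ioc X (X + L),
                  (ArithmeticFunction.liouville (Int.toNat ((u : ℤ) * n₁ + a₁)) : ℝ) *
                    (ArithmeticFunction.liouville (Int.toNat ((u : ℤ) * n₂ + a₂)) : ℝ)| ≤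
                C * (X : ℝ) ^ (1 - κ)) →
    (∀ φ : ℝ → ℝ, ContDiff ℝ (⊤ : ℕ∞) φ → (∀ x : ℝ, φ x ≠ 0 → |x| ≤ 2) →
      ∀ c : ℤ, c ≠ 0 → ∀ δ : ℝ, 0 < δ → ∃ ϑ : ℝ, ϑ < 1 / 4 ∧ ∃ C : ℝ,
        ∀ M n n' : ℕ, ∀ k : ℤ, ∀ P D : ℝ,
          1 ≤ n → 1 ≤ n' → n ≠ n' → n ≤ 2 * M → n' ≤ 2 * M → k ≠ 0 →
            (M : ℝ) ^ δ ≤ D → 8 * D ≤ (Nat.sqrt M : ℝ) + 1 →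
              (Nat.sqrt M : ℝ) + 1 ≤ P → P ≤ 2 * ((Nat.sqrt M : ℝ) + 1) →
                |∑ j ∈ Finset.Icc 1 (2 * M), φ (((j : ℝ) - P) / D) *
                    ∑ p ∈ (Finset.Ioc M (2 * M) ×ˢ Finset.Ioc M (2 * M)).filter
                        (fun p : ℕ × ℕ => (p.1 : ℤ) - p.2 = k * (j : ℤ)),
                      (ArithmeticFunction.liouville (Int.toNat ((p.1 : ℤ) * n + c)) : ℝ) *
                        (ArithmeticFunction.liouville (Int.toNat ((p.2 : ℤ) * n' + c)) : ℝ)| ≤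
                  C * (M : ℝ) ^ (3 / 4 + ϑ)) →
    ∀ c : ℤ, c ≠ 0 → ∃ ϑ : ℝ, ϑ < 1 / 4 ∧ ∃ C : ℝ, ∀ M n n' : ℕ, ∀ k : ℤ,
      1 ≤ n → 1 ≤ n' → n ≠ n' → n ≤ 2 * M → n' ≤ 2 * M → k ≠ 0 →
        |∑ j ∈ Finset.Ico (Nat.sqrt M + 1) (2 * (Nat.sqrt M + 1)),
            ∑ p ∈ (Finset.Ioc M (2 * M) ×ˢ Finset.Ioc M (2 * M)).filter
                (fun p : ℕ × ℕ => (p.1 : ℤ) - p.2 = k * (j : ℤ)),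
              (ArithmeticFunction.liouville (Int.toNat ((p.1 : ℤ) * n + c)) : ℝ) *
                (ArithmeticFunction.liouville (Int.toNat ((p.2 : ℤ) * n' + c)) : ℝ)| ≤
          C * (M : ℝ) ^ (3 / 4 + ϑ) :=
  fun h₁ h₂ => FanOfHeightLaws.stub_fanOfHeightLaws (PointwiseOfBinaryForms.stub_pointwiseOfBinaryForms h₁) h₂

end Summit.Parity.GeneralizedHardyLittlewood.Theorems.FanDecorrelation.FanOfBinaryFormsWide
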